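import Literature.NumberTheory.Sieve.FriedlanderIwaniecPrimesLinearForms
import HarnessLib

/-!
# Friedlander–Iwaniec, *The polynomial `X² + Y⁴` captures its primes*, §23: linear forms in the quadratic eigenvalues (Proposition 23.2)

Family `parity` (rung F-SPIN: Theorem 2 / Theorem 2^ψ; the type-I input of §26). Source:
J. Friedlander, H. Iwaniec, Ann. of Math. (2) 148 (1998), 945–1040 [FriedlanderIwaniecAnnals1998]
(= arXiv:math/9811185), §23 "Linear and bilinear forms in quadratic eigenvalues", (23.1), (23.9),
(23.11), Proposition 23.2 (arXiv p. 81): for the quadratic eigenvalues `λ(n) = Σ^∧_{z z̄ = n} ψ(z)[z]`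
((23.1)) of a Hecke character `ψ` (17.17) to modulus `4d` and frequency `k`, and the special linear
forms (23.9) `ℒ(N) = Σ_{n ≤ N} λ(mn)`, "PROPOSITION 23.2. Given a Hecke character `ψ` defined by
(17.17) and a positive integer `m` we have the bounds (23.11) `ℒ(N) ≪ d(|k|+1) τ(m)⁴ √m N^{3/4} log mN`
… where the implied constant is absolute."

## What is proved (everything; no named facts)

* `heckePsi_mul` — `ψ(wz) = ψ(w)ψ(z)`.
* (private) unique factorisation of primitive primary numbers along a divisor of the norm:
  `exists_isPrimary_dvd_norm_eq` (for `ζ` primary primitive and `m ∣ ζ ζ̄`, there is a primary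
  `w ∣ ζ` with `w w̄ = m`) and `eq_of_isPrimary_dvd_norm_eq` (it is unique).
* `sum_quadEigenvalue_mul_eq` — **the factorisation of `ℒ(N)`**:
  `Σ_{n ≤ N} λ(mn) = Σ_{w primary, w w̄ = m} ψ(w) Σ_{z primary, 1 ≤ z z̄ ≤ N} ψ(z)[wz]` (exactly; the
  non-primitive `ζ = wz`, which are counted with multiplicity on the right, have `[ζ] = 0`).
* `norm_sum_quadEigenvalue_mul_le` — **Proposition 23.2 (23.11)** with `τ(m)` in place of `τ(m)⁴`:
  an absolute `C` with `‖Σ_{n ≤ N} λ(mn)‖ ≤ C d(|k|+1) τ(m) √m N^{3/4} log(mN)` for all `d, m ≥ 1`,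
  `N ≥ 2`, all `χ`, `k`; `norm_sum_quadEigenvalue_mul_le'` — the printed shape (23.11) (with `τ(m)⁴`),
  literally the body of the F-SPIN skeleton's `Prop232`.

DEVIATION from the printed route (a shorter road, same ingredients): the source derives (23.11) from
the starred bound (22.4) via (23.12) (`(n, m) = 1`) and a resummation over `n = c n'`, `c ∣ m^∞`;
here (23.11) follows directly from the UNSTARRED (22.3) (`norm_linearFormK_le`) by the unique
factorisation `ζ = w z` of a primitive primary `ζ` with `m ∣ ζ ζ̄` (`w ∣ ζ` primary, `w w̄ = m`), which
is elementary arithmetic of `ℤ[i]` (a prime `p ∣ ζ ζ̄` is `≡ 1 (mod 4)` and exactly one of `π, π̄`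
divides `ζ`). This also improves `τ(m)⁴` to `τ(m)`.

## References

* J. Friedlander, H. Iwaniec, Ann. of Math. (2) 148 (1998), 945–1040, §23, (23.1)–(23.3),
  (23.9)–(23.12), Proposition 23.2. [FriedlanderIwaniecAnnals1998]

## Tree / Mathlib

Tree: `norm_linearFormK_le`, `primaryNormLE`, `norm_heckePsi_le_one`, `norm_jacobiKubota_le_one`
(`FriedlanderIwaniecPrimesLinearForms`), `heckePsi`, `quadEigenvalue` (`FriedlanderIwaniecSpin`),
`jacobiKubota_eq_zero_of_not_isPrimitive`, `GaussianPrimary.*` (`isPrimary_iff_dvd`, `IsPrimary.mul`,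
`IsPrimary.star`, `exists_isPrimary_norm_eq`, `prime_of_norm_eq_prime`, `not_dvd_star_of_norm_eq_prime`,
`natCast_eq_mul_star`, `natCast_dvd_of_dvd_star`, `cast_norm_eq`, `eq_of_isUnit`, `mem_primaryNormEq`),
`card_primaryNormEq_le_card_divisors` (`GaussianNormCount`), `not_natCast_dvd_of_isPrimitive`,
`re_odd_of_isPrimary` (`…DirichletSymbol`). Mathlib: `GaussianInt.prime_of_nat_prime_of_mod_four_eq_three`,
`Finset.sum_bij_ne_zero`, `Zsqrtd.norm_conj`.
-/

noncomputable section

open Finset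
open scoped NumberTheorySymbols

namespace Literature.NumberTheory.Sieve.FriedlanderIwaniecPrimes

open Literature.NumberTheory.QuadraticFields Literature.NumberTheory.QuadraticFields.GaussianPrimary
open Literature.NumberTheory.LFunctions.GaussianInt (IsPrimitive)
open GaussianInt (toComplex)

/-! ### Multiplicativity of `ψ` -/

/-- `ψ(wz) = ψ(w) ψ(z)` for the Hecke character (17.17). [cite: FriedlanderIwaniecAnnals1998, (17.17)] -/
theorem heckePsi_mul (d : ℕ) (χ : MulChar (GaussQuot (4 * d)) ℂ) (k : ℤ) (w z : GaussianInt) :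
    heckePsi d χ k (w * z) = heckePsi d χ k w * heckePsi d χ k z := by
  unfold heckePsi
  rw [map_mul, map_mul, GaussianInt.toComplex_mul, norm_mul, Complex.ofReal_mul,
    ← div_mul_div_comm, mul_zpow]
  ring

/-! ### Primitive primary numbers: factorisation along a divisor of the norm -/

/-- A divisor of a primitive number is primitive. [folklore] -/
private theorem isPrimitive_of_dvd {x ζ : GaussianInt} (hζ : IsPrimitive ζ) (h : x ∣ ζ) :
    IsPrimitive x := by
  by_contra hx
  have hg : Int.gcd x.re x.im ≠ 1 := hx
  rcases Nat.eq_zero_or_pos (Int.gcd x.re x.im) with h0 | hpos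
  · rw [Int.gcd_eq_zero_iff] at h0
    have hx0 : x = 0 := Zsqrtd.ext h0.1 h0.2
    rw [hx0] at h
    have hζ0 : ζ = 0 := zero_dvd_iff.mp h
    have : Int.gcd ζ.re ζ.im = 1 := hζ
    rw [hζ0] at this
    simp at this
  · have hg1 : 1 < Int.gcd x.re x.im := by omega
    have hdvd : ((Int.gcd x.re x.im : ℕ) : GaussianInt) ∣ x := by
      rw [natCast_dvd_iff]; exact ⟨Int.gcd_dvd_left _ _, Int.gcd_dvd_right _ _⟩
    exact not_natCast_dvd_of_isPrimitive hζ hg1 (hdvd.trans h)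

/-- If `w` and `w y` are primary then so is `y`. [folklore] -/
private theorem isPrimary_of_mul_left {w y : GaussianInt} (hwy : IsPrimary (w * y)) (hw : IsPrimary w) :
    IsPrimary y := by
  rw [isPrimary_iff_dvd] at hwy hw ⊢
  have h : w * y - 1 - y * (w - 1) = y - 1 := by ring
  rw [← h]
  exact dvd_sub hwy (hw.mul_left y)

/-- A primary unit is `1`. [folklore] -/
private theorem eq_one_of_isPrimary_of_norm_eq_one {u : GaussianInt} (hu : IsPrimary u) (h : u.norm = 1) :
    u = 1 := by
  have hunit : IsUnit u := (Zsqrtd.norm_eq_one_iff' (by norm_num) u).mp h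
  rcases eq_of_isUnit hunit with rfl | rfl | rfl | rfl
  · rfl
  all_goals exact absurd hu (by decide)

/-- **A prime `p` dividing the norm of a primitive primary `ζ` is `≡ 1 (mod 4)` and exactly one of
the two primary primes above it divides `ζ`**: there is `ρ` primary with `ρ ρ̄ = p`, `ρ ∣ ζ` and
`ρ̄ ∤ ζ`. [folklore] -/
private theorem exists_isPrimary_prime_dvd {ζ : GaussianInt} (hζp : IsPrimary ζ) (hζ : IsPrimitive ζ)
    {p : ℕ} (hp : p.Prime) (hpd : (p : ℤ) ∣ ζ.norm) :
    ∃ ρ : GaussianInt, IsPrimary ρ ∧ ρ.norm = p ∧ ρ ∣ ζ ∧ ¬ star ρ ∣ ζ := by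
  -- `p ∣ ζ ζ̄` in `ℤ[i]`
  have hpd' : (p : GaussianInt) ∣ ζ * star ζ := by
    obtain ⟨c, hc⟩ := hpd
    refine ⟨(c : GaussianInt), ?_⟩
    rw [← cast_norm_eq, hc]; push_cast; ring
  have hnp : ¬ (p : GaussianInt) ∣ ζ := not_natCast_dvd_of_isPrimitive hζ hp.one_lt
  -- `p` is odd and `≢ 3 (mod 4)`
  have hodd : ζ.norm % 2 = 1 := hζp.norm_odd
  have hp2 : p ≠ 2 := by
    rintro rfl
    obtain ⟨c, hc⟩ := hpd
    omega
  haveI : Fact p.Prime := ⟨hp⟩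
  have hp4 : p % 4 = 1 := by
    rcases hp.eq_two_or_odd' with h | h
    · exact absurd h hp2
    · by_contra h4
      have h3 : p % 4 = 3 := by obtain ⟨m, hm⟩ := h; omega
      have hprime : Prime (p : GaussianInt) := GaussianInt.prime_of_nat_prime_of_mod_four_eq_three p h3
      rcases hprime.dvd_or_dvd hpd' with h1 | h1
      · exact hnp h1
      · exact hnp (natCast_dvd_of_dvd_star h1)
  obtain ⟨π₀, hπp, hπn⟩ := exists_isPrimary_norm_eq (p := p) hp4
  have hπprime : Prime π₀ := prime_of_norm_eq_prime hp hπn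
  have hpeq : (p : GaussianInt) = π₀ * star π₀ := natCast_eq_mul_star hπn
  have hkey : ∀ ρ : GaussianInt, IsPrimary ρ → ρ.norm = p → ρ ∣ ζ → ¬ star ρ ∣ ζ := by
    intro ρ hρp hρn hρ hsρ
    -- `ρ ρ̄ = p ∣ ζ`
    have hρprime : Prime (star ρ) := prime_of_norm_eq_prime hp (by rw [Zsqrtd.norm_conj, hρn])
    obtain ⟨c, hc⟩ := hρ
    have h1 : star ρ ∣ c := by
      rw [hc] at hsρ
      rcases hρprime.dvd_or_dvd hsρ with h | h
      · exact absurd h (by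
          have := not_dvd_star_of_norm_eq_prime hp hp4
            (show (star ρ).norm = (p : ℤ) by rw [Zsqrtd.norm_conj, hρn])
          rwa [star_star] at this)
      · exact h
    obtain ⟨e, he⟩ := h1
    apply hnp
    refine ⟨e, ?_⟩
    rw [natCast_eq_mul_star hρn, hc, he]; ring
  rcases hπprime.dvd_or_dvd ((dvd_mul_right π₀ (star π₀)).trans (hpeq ▸ hpd')) with h | h
  · exact ⟨π₀, hπp, hπn, h, hkey π₀ hπp hπn h⟩
  · -- `π₀ ∣ ζ̄`, so `π̄₀ ∣ ζ`
    have h' : star π₀ ∣ ζ := by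
      obtain ⟨c, hc⟩ := h
      refine ⟨star c, ?_⟩
      rw [← star_mul', ← hc, star_star]
    have hn' : (star π₀).norm = p := by rw [Zsqrtd.norm_conj, hπn]
    exact ⟨star π₀, hπp.star, hn', h', hkey _ hπp.star hn' h'⟩

/-- **Existence**: for `ζ` primary primitive and `m ∣ ζ ζ̄` there is a primary `w ∣ ζ` with
`w w̄ = m`. [folklore] -/
private theorem exists_isPrimary_dvd_norm_eq : ∀ (m : ℕ) {ζ : GaussianInt}, IsPrimary ζ → IsPrimitive ζ →
    (m : ℤ) ∣ ζ.norm → ∃ w : GaussianInt, IsPrimary w ∧ w ∣ ζ ∧ w.norm = m := by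
  intro m
  induction m using Nat.strong_induction_on with
  | _ m ih =>
    intro ζ hζp hζ hm
    have hm0 : m ≠ 0 := by
      rintro rfl
      simp only [Nat.cast_zero, zero_dvd_iff] at hm
      exact hζp.ne_zero (GaussianInt.norm_eq_zero.mp hm)
    by_cases hm1 : m = 1
    · subst hm1; exact ⟨1, isPrimary_one, one_dvd _, Zsqrtd.norm_one⟩
    obtain ⟨p, hp, hpm⟩ := Nat.exists_prime_and_dvd hm1
    obtain ⟨ρ, hρp, hρn, hρζ, -⟩ := exists_isPrimary_prime_dvd hζp hζ hp
      ((Int.natCast_dvd_natCast.mpr hpm).trans hm)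
    obtain ⟨ζ', hζ'⟩ := hρζ
    have hζ'p : IsPrimary ζ' := isPrimary_of_mul_left (hζ' ▸ hζp) hρp
    have hζ'prim : IsPrimitive ζ' := isPrimitive_of_dvd hζ ⟨ρ, by rw [hζ', mul_comm]⟩
    have hnorm : ζ.norm = p * ζ'.norm := by rw [hζ', Zsqrtd.norm_mul, hρn]
    obtain ⟨m', hm'⟩ := hpm
    have hm'lt : m' < m := by
      rw [hm']; exact lt_mul_left (Nat.pos_of_ne_zero (by rintro rfl; simp at hm'; exact hm0 hm')) hp.one_lt
    have hm'd : (m' : ℤ) ∣ ζ'.norm := by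
      rw [hm', hnorm] at hm
      push_cast at hm
      exact Int.dvd_of_mul_dvd_mul_left (by exact_mod_cast hp.ne_zero) hm
    obtain ⟨w', hw'p, hw'ζ, hw'n⟩ := ih m' hm'lt hζ'p hζ'prim hm'd
    refine ⟨ρ * w', hρp.mul hw'p, ?_, ?_⟩
    · rw [hζ']; exact mul_dvd_mul_left ρ hw'ζ
    · rw [Zsqrtd.norm_mul, hρn, hw'n, hm']; push_cast; ring

/-- **Uniqueness**: two primary divisors of a primitive primary `ζ` with the same norm are equal.
[folklore] -/
private theorem eq_of_isPrimary_dvd_norm_eq : ∀ (m : ℕ) {ζ w₁ w₂ : GaussianInt}, IsPrimary ζ → IsPrimitive ζ →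
    IsPrimary w₁ → IsPrimary w₂ → w₁ ∣ ζ → w₂ ∣ ζ → w₁.norm = m → w₂.norm = m → w₁ = w₂ := by
  intro m
  induction m using Nat.strong_induction_on with
  | _ m ih =>
    intro ζ w₁ w₂ hζp hζ hw₁ hw₂ h₁ h₂ hn₁ hn₂
    by_cases hm1 : m ≤ 1
    · have hm : m = 1 := by
        have : 0 < w₁.norm := GaussianInt.norm_pos.mpr hw₁.ne_zero
        rw [hn₁] at this
        have : 0 < m := by exact_mod_cast this
        omega
      subst hm
      rw [eq_one_of_isPrimary_of_norm_eq_one hw₁ (by exact_mod_cast hn₁),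
        eq_one_of_isPrimary_of_norm_eq_one hw₂ (by exact_mod_cast hn₂)]
    have hm1' : m ≠ 1 := by omega
    obtain ⟨p, hp, hpm⟩ := Nat.exists_prime_and_dvd hm1'
    have hpζ : (p : ℤ) ∣ ζ.norm :=
      ((Int.natCast_dvd_natCast.mpr hpm).trans (hn₁ ▸ norm_dvd_norm h₁ : (m : ℤ) ∣ ζ.norm))
    obtain ⟨ρ, hρp, hρn, hρζ, hρbar⟩ := exists_isPrimary_prime_dvd hζp hζ hp hpζ
    have hρprime : Prime ρ := prime_of_norm_eq_prime hp hρn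
    -- `ρ ∣ wᵢ`
    have hρw : ∀ {w : GaussianInt}, w ∣ ζ → w.norm = m → ρ ∣ w := by
      intro w hw hwn
      have hpw : (p : GaussianInt) ∣ w * star w := by
        rw [← cast_norm_eq, hwn]
        obtain ⟨c, hc⟩ := hpm
        exact ⟨(c : GaussianInt), by rw [hc]; push_cast; ring⟩
      rw [natCast_eq_mul_star hρn] at hpw
      rcases hρprime.dvd_or_dvd ((dvd_mul_right ρ (star ρ)).trans hpw) with h | h
      · exact h
      · exfalso
        apply hρbar
        obtain ⟨c, hc⟩ := h
        have : star ρ ∣ w := ⟨star c, by rw [← star_mul', ← hc, star_star]⟩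
        exact this.trans hw
    obtain ⟨w₁', hw₁'⟩ := hρw h₁ hn₁
    obtain ⟨w₂', hw₂'⟩ := hρw h₂ hn₂
    obtain ⟨ζ', hζ'⟩ := hρζ
    have hρ0 : ρ ≠ 0 := hρp.ne_zero
    have hζ'p : IsPrimary ζ' := isPrimary_of_mul_left (hζ' ▸ hζp) hρp
    have hζ'prim : IsPrimitive ζ' := isPrimitive_of_dvd hζ ⟨ρ, by rw [hζ', mul_comm]⟩
    have hw₁'p : IsPrimary w₁' := isPrimary_of_mul_left (hw₁' ▸ hw₁) hρp
    have hw₂'p : IsPrimary w₂' := isPrimary_of_mul_left (hw₂' ▸ hw₂) hρp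
    have hd₁ : w₁' ∣ ζ' := by
      have : ρ * w₁' ∣ ρ * ζ' := by rw [← hw₁', ← hζ']; exact h₁
      exact (mul_dvd_mul_iff_left hρ0).mp this
    have hd₂ : w₂' ∣ ζ' := by
      have : ρ * w₂' ∣ ρ * ζ' := by rw [← hw₂', ← hζ']; exact h₂
      exact (mul_dvd_mul_iff_left hρ0).mp this
    obtain ⟨m', hm'⟩ := hpm
    have hm'lt : m' < m := by
      rw [hm']
      exact lt_mul_left (Nat.pos_of_ne_zero (by rintro rfl; simp at hm'; omega)) hp.one_lt
    have hp0 : (p : ℤ) ≠ 0 := by exact_mod_cast hp.ne_zero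
    have hn₁' : w₁'.norm = m' := by
      have : (p : ℤ) * w₁'.norm = p * m' := by
        rw [← hρn, ← Zsqrtd.norm_mul, ← hw₁', hn₁, hm']; push_cast; rw [hρn]
      exact mul_left_cancel₀ hp0 this
    have hn₂' : w₂'.norm = m' := by
      have : (p : ℤ) * w₂'.norm = p * m' := by
        rw [← hρn, ← Zsqrtd.norm_mul, ← hw₂', hn₂, hm']; push_cast; rw [hρn]
      exact mul_left_cancel₀ hp0 this
    rw [hw₁', hw₂', ih m' hm'lt hζ'p hζ'prim hw₁'p hw₂'p hd₁ hd₂ hn₁' hn₂']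

/-! ### The factorisation of `ℒ(N)` -/

/-- A primary number that is not primitive has `[ζ] = 0`. [cite: FriedlanderIwaniecAnnals1998, §20 after (20.1)] -/
private theorem jacobiKubota_eq_zero_of_isPrimary {ζ : GaussianInt} (hζ : IsPrimary ζ)
    (h : ¬ IsPrimitive ζ) : jacobiKubota ζ = 0 :=
  jacobiKubota_eq_zero_of_not_isPrimitive h (by have := re_odd_of_isPrimary hζ; omega)

/-- **The factorisation of the linear form (23.9)**:
`Σ_{n ≤ N} λ(mn) = Σ_{w primary, w w̄ = m} ψ(w) · Σ_{z primary, 1 ≤ z z̄ ≤ N} ψ(z) [wz]` (`m ≥ 1`).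
On the right a primitive `ζ = wz` arises exactly once (`exists_isPrimary_dvd_norm_eq`,
`eq_of_isPrimary_dvd_norm_eq`); the non-primitive ones have `[ζ] = 0`. (The source's route is
`ℒ*(N) = Σ^∧_{ww̄ = m} ψ(w) Σ_{(z,w)=1} ψ(z)[wz]` for `(n, m) = 1` plus a resummation over `c ∣ m^∞`;
this identity needs no coprimality.) [cite: FriedlanderIwaniecAnnals1998, (23.9)–(23.12)] -/
theorem sum_quadEigenvalue_mul_eq (d : ℕ) (χ : MulChar (GaussQuot (4 * d)) ℂ) (k : ℤ) {m : ℕ}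
    (hm : 1 ≤ m) (N : ℕ) :
    ∑ n ∈ Icc 1 N, quadEigenvalue d χ k (m * n) =
      ∑ w ∈ primaryNormEq m, heckePsi d χ k w *
        ∑ z ∈ primaryNormLE N, heckePsi d χ k z * jacobiKubota (w * z) := by
  have hm0 : (m : ℤ) ≠ 0 := by exact_mod_cast (by omega : m ≠ 0)
  -- the left side as one sum over `ζ`
  set Z : Finset GaussianInt := (Icc 1 N).biUnion fun n => primaryNormEq (m * n) with hZ
  have hdisj : Set.PairwiseDisjoint (↑(Icc 1 N) : Set ℕ) fun n => primaryNormEq (m * n) := by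
    intro n₁ _ n₂ _ hne
    rw [Function.onFun, disjoint_left]
    intro ζ h1 h2
    rw [mem_primaryNormEq] at h1 h2
    apply hne
    have : (m : ℤ) * n₁ = m * n₂ := by
      have h := h1.1.symm.trans h2.1; push_cast at h; exact h
    exact_mod_cast mul_left_cancel₀ hm0 this
  have hL : ∑ n ∈ Icc 1 N, quadEigenvalue d χ k (m * n) =
      ∑ ζ ∈ Z, heckePsi d χ k ζ * jacobiKubota ζ := by
    rw [hZ, sum_biUnion hdisj]; rfl
  have hR : ∑ w ∈ primaryNormEq m, heckePsi d χ k w *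
        ∑ z ∈ primaryNormLE N, heckePsi d χ k z * jacobiKubota (w * z) =
      ∑ p ∈ primaryNormEq m ×ˢ primaryNormLE N,
        heckePsi d χ k p.1 * (heckePsi d χ k p.2 * jacobiKubota (p.1 * p.2)) := by
    rw [sum_product]
    exact sum_congr rfl fun w _ => by rw [mul_sum]
  rw [hL, hR]
  symm
  refine Finset.sum_bij_ne_zero (fun p _ _ => p.1 * p.2) ?_ ?_ ?_ ?_
  · -- maps into `Z`
    rintro ⟨w, z⟩ hp -
    rw [mem_product] at hp
    obtain ⟨hw, hz⟩ := hp
    rw [mem_primaryNormEq] at hw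
    rw [mem_primaryNormLE] at hz
    simp only [hZ, mem_biUnion, mem_Icc, mem_primaryNormEq]
    refine ⟨z.norm.toNat, ⟨?_, ?_⟩, ?_, hw.2.mul hz.1⟩
    · have : (1 : ℤ) ≤ z.norm.toNat := by rw [Int.toNat_of_nonneg (by linarith)]; exact hz.2.1
      exact_mod_cast this
    · have : (z.norm.toNat : ℤ) ≤ N := by rw [Int.toNat_of_nonneg (by linarith)]; exact hz.2.2
      exact_mod_cast this
    · rw [Zsqrtd.norm_mul, hw.1]; push_cast; rw [Int.toNat_of_nonneg (by linarith)]
  · -- injective on the support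
    rintro ⟨w, z⟩ hp hne ⟨w', z'⟩ hp' hne' heq
    simp only at heq
    rw [mem_product, mem_primaryNormEq, mem_primaryNormLE] at hp hp'
    have hζp : IsPrimary (w * z) := hp.1.2.mul hp.2.1
    have hζ : IsPrimitive (w * z) := by
      by_contra h
      exact hne (by rw [jacobiKubota_eq_zero_of_isPrimary hζp h, mul_zero, mul_zero])
    have hww' : w = w' :=
      eq_of_isPrimary_dvd_norm_eq m hζp hζ hp.1.2 hp'.1.2 (dvd_mul_right w z)
        (heq ▸ dvd_mul_right w' z') hp.1.1 hp'.1.1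
    subst hww'
    have hzz' : z = z' := mul_left_cancel₀ hp.1.2.ne_zero heq
    subst hzz'
    rfl
  · -- surjective onto the support
    intro ζ hζZ hne
    simp only [hZ, mem_biUnion, mem_Icc, mem_primaryNormEq] at hζZ
    obtain ⟨n, ⟨hn1, hnN⟩, hζn, hζp⟩ := hζZ
    have hζ : IsPrimitive ζ := by
      by_contra h
      exact hne (by rw [jacobiKubota_eq_zero_of_isPrimary hζp h, mul_zero])
    obtain ⟨w, hwp, hwζ, hwn⟩ := exists_isPrimary_dvd_norm_eq m hζp hζ ⟨n, by rw [hζn]; push_cast; ring⟩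
    obtain ⟨z, hz⟩ := hwζ
    have hzp : IsPrimary z := isPrimary_of_mul_left (hz ▸ hζp) hwp
    have hzn : z.norm = n := by
      have : (m : ℤ) * z.norm = m * n := by
        rw [← hwn, ← Zsqrtd.norm_mul, ← hz, hζn]; push_cast; rw [hwn]
      exact mul_left_cancel₀ hm0 this
    refine ⟨(w, z), ?_, ?_, hz.symm⟩
    · rw [mem_product, mem_primaryNormEq, mem_primaryNormLE]
      refine ⟨⟨hwn, hwp⟩, hzp, ?_, ?_⟩
      · rw [hzn]; exact_mod_cast hn1
      · rw [hzn]; exact_mod_cast hnN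
    · simp only
      rwa [← mul_assoc, ← heckePsi_mul, ← hz]
  · -- values agree
    rintro ⟨w, z⟩ - -
    simp only
    rw [← mul_assoc, ← heckePsi_mul]

/-! ### Proposition 23.2 -/

/-- `√m ≤ m` for `m ≥ 1`. [folklore] -/
private theorem sqrt_natCast_le_self {m : ℕ} (hm : 1 ≤ m) : Real.sqrt (m : ℝ) ≤ m := by
  have h1 : (1 : ℝ) ≤ m := by exact_mod_cast hm
  calc Real.sqrt (m : ℝ) ≤ Real.sqrt ((m : ℝ) ^ 2) := Real.sqrt_le_sqrt (by nlinarith)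
    _ = m := Real.sqrt_sq (by linarith)

/-- **Friedlander–Iwaniec, Proposition 23.2, (23.11), with `τ(m)` for `τ(m)⁴`.** There is an
absolute `C` with `‖Σ_{n ≤ N} λ(mn)‖ ≤ C · d(|k|+1) · τ(m) √m · N^{3/4} log(mN)` for every `d ≥ 1`,
every character `χ` of `ℤ[i]/(4d)`, every `k ∈ ℤ`, every `m ≥ 1` and every `N ≥ 2`
(`λ = quadEigenvalue d χ k`, (23.1)). [cite: FriedlanderIwaniecAnnals1998, Proposition 23.2 (23.11)] -/
theorem norm_sum_quadEigenvalue_mul_le :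
    ∃ C : ℝ, 0 < C ∧ ∀ d : ℕ, 1 ≤ d → ∀ χ : MulChar (GaussQuot (4 * d)) ℂ, ∀ k : ℤ,
      ∀ m : ℕ, 1 ≤ m → ∀ N : ℕ, 2 ≤ N →
        ‖∑ n ∈ Icc 1 N, quadEigenvalue d χ k (m * n)‖ ≤
          C * (d * (|k| + 1 : ℝ)) * (m.divisors.card : ℝ) * Real.sqrt m * (N : ℝ) ^ (3 / 4 : ℝ) *
            Real.log ((m : ℝ) * N) := by
  obtain ⟨C, hC, h⟩ := norm_linearFormK_le
  refine ⟨C, hC, fun d hd χ k m hm N hN => ?_⟩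
  haveI : NeZero d := ⟨by omega⟩
  rw [sum_quadEigenvalue_mul_eq d χ k hm N]
  have hm1 : (1 : ℝ) ≤ m := by exact_mod_cast hm
  have hN2 : (2 : ℝ) ≤ N := by exact_mod_cast hN
  have hsqrt1 : 1 ≤ Real.sqrt (m : ℝ) := by
    rw [← Real.sqrt_one]; exact Real.sqrt_le_sqrt hm1
  have hlogle : Real.log (Real.sqrt m * N) ≤ Real.log ((m : ℝ) * N) :=
    Real.log_le_log (by positivity) (mul_le_mul_of_nonneg_right (sqrt_natCast_le_self hm) (by positivity))
  have hlog0 : 0 ≤ Real.log (Real.sqrt m * N) := Real.log_nonneg (by nlinarith)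
  set B : ℝ := C * (d * (|k| + 1 : ℝ)) * Real.sqrt m * (N : ℝ) ^ (3 / 4 : ℝ) * Real.log ((m : ℝ) * N)
    with hB
  have hB0 : 0 ≤ B := by
    have : 0 ≤ Real.log ((m : ℝ) * N) := hlog0.trans hlogle
    positivity
  have hterm : ∀ w ∈ primaryNormEq m,
      ‖heckePsi d χ k w * ∑ z ∈ primaryNormLE N, heckePsi d χ k z * jacobiKubota (w * z)‖ ≤ B := by
    intro w hw
    rw [mem_primaryNormEq] at hw
    have hK := h d hd χ k w hw.2 N hN
    rw [hw.1, Int.cast_natCast] at hK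
    rw [norm_mul]
    calc ‖heckePsi d χ k w‖ * _ ≤ 1 * (C * (d * (|k| + 1 : ℝ)) * Real.sqrt m * (N : ℝ) ^ (3 / 4 : ℝ) *
          Real.log (Real.sqrt m * N)) :=
          mul_le_mul (norm_heckePsi_le_one d χ k w) hK (norm_nonneg _) zero_le_one
      _ ≤ B := by
          rw [one_mul, hB]
          exact mul_le_mul_of_nonneg_left hlogle (by positivity)
  calc ‖∑ w ∈ primaryNormEq m, heckePsi d χ k w *
          ∑ z ∈ primaryNormLE N, heckePsi d χ k z * jacobiKubota (w * z)‖
      ≤ ∑ w ∈ primaryNormEq m, ‖heckePsi d χ k w *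
          ∑ z ∈ primaryNormLE N, heckePsi d χ k z * jacobiKubota (w * z)‖ := norm_sum_le _ _
    _ ≤ ∑ w ∈ primaryNormEq m, B := sum_le_sum hterm
    _ = (primaryNormEq m).card * B := by rw [sum_const, nsmul_eq_mul]
    _ ≤ (m.divisors.card : ℝ) * B :=
        mul_le_mul_of_nonneg_right (by exact_mod_cast card_primaryNormEq_le_card_divisors m (by omega)) hB0
    _ = _ := by rw [hB]; ring

/-- **Proposition 23.2, (23.11), as printed** (factor `τ(m)⁴`; this is literally the body of the
F-SPIN skeleton's `Prop232`). [cite: FriedlanderIwaniecAnnals1998, Proposition 23.2 (23.11)] -/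
theorem norm_sum_quadEigenvalue_mul_le' :
    ∃ C : ℝ, ∀ d : ℕ, 1 ≤ d → ∀ χ : MulChar (GaussQuot (4 * d)) ℂ,
      ∀ k : ℤ, ∀ m : ℕ, 1 ≤ m → ∀ N : ℕ, 2 ≤ N →
        ‖∑ n ∈ Icc 1 N, quadEigenvalue d χ k (m * n)‖ ≤
          C * (d * (|k| + 1 : ℝ)) * ((m.divisors.card : ℝ) ^ 4) * Real.sqrt m * (N : ℝ) ^ (3 / 4 : ℝ) *
            Real.log ((m : ℝ) * N) := by
  obtain ⟨C, hC, h⟩ := norm_sum_quadEigenvalue_mul_le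
  refine ⟨C, fun d hd χ k m hm N hN => (h d hd χ k m hm N hN).trans ?_⟩
  have hτ1 : (1 : ℝ) ≤ m.divisors.card := by
    have : 1 ≤ m.divisors.card := card_pos.mpr ⟨1, Nat.one_mem_divisors.mpr (by omega)⟩
    exact_mod_cast this
  have hτ4 : (m.divisors.card : ℝ) ≤ (m.divisors.card : ℝ) ^ 4 := by
    calc (m.divisors.card : ℝ) = (m.divisors.card : ℝ) ^ 1 := (pow_one _).symm
      _ ≤ (m.divisors.card : ℝ) ^ 4 := pow_le_pow_right₀ hτ1 (by norm_num)
  have hm1 : (1 : ℝ) ≤ m := by exact_mod_cast hm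
  have hN2 : (2 : ℝ) ≤ N := by exact_mod_cast hN
  have hlog0 : 0 ≤ Real.log ((m : ℝ) * N) := Real.log_nonneg (by nlinarith)
  have h0 : 0 ≤ C * (d * (|k| + 1 : ℝ)) := by positivity
  have h1 : 0 ≤ Real.sqrt m * (N : ℝ) ^ (3 / 4 : ℝ) * Real.log ((m : ℝ) * N) := by positivity
  calc C * (d * (|k| + 1 : ℝ)) * (m.divisors.card : ℝ) * Real.sqrt m * (N : ℝ) ^ (3 / 4 : ℝ) *
        Real.log ((m : ℝ) * N)
      = C * (d * (|k| + 1 : ℝ)) * (m.divisors.card : ℝ) *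
          (Real.sqrt m * (N : ℝ) ^ (3 / 4 : ℝ) * Real.log ((m : ℝ) * N)) := by ring
    _ ≤ C * (d * (|k| + 1 : ℝ)) * (m.divisors.card : ℝ) ^ 4 *
          (Real.sqrt m * (N : ℝ) ^ (3 / 4 : ℝ) * Real.log ((m : ℝ) * N)) :=
        mul_le_mul_of_nonneg_right (mul_le_mul_of_nonneg_left hτ4 h0) h1
    _ = _ := by ring

end Literature.NumberTheory.Sieve.FriedlanderIwaniecPrimes
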